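import Summits.BirchSwinnertonDyer.BirchSwinnertonDyer.Theorems.Rank1ResidualJetSelmerLemmas
import Literature.NumberTheory.GaloisCohomology.KolyvaginSystems
import Literature.NumberTheory.GaloisRepresentations.ContinuousH1
import Literature.NumberTheory.GaloisRepresentations.ToLocalRestrictField
import HarnessLib

/-!
# T1 JET (cell `bsd-jet`), road K: Jetchev's transverse condition as the tree's INTRINSIC local
# object `transverseSubgroup (E[n]|_{K_λ}) (K[ℓ]_{w'})`, and the reconciliation `hT` of the H63 line
# for it (gap G2, sharpened to a kernel statement)

HONEST FRAMING (programme file §HONESTY, verbatim): «no tranche here proves BSD; ARM L moves the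
LITERAL column of an r ≤ 1 census into the kernel-proved-modulo-named-print column.» THEOREMS ONLY
(seat `bsd-jet-pv-2`, session g4; `--supports stmt-BirchSwinnertonDyer-14418`, helper); 0 classes
move. WHAT THIS IS. The H63 line (`JET.tamagawaExponent_le_mInfty_of_localInputs`, this seat) takes a
Selmer structure `𝒯` (Jetchev's transverse condition `H¹_tr(K_λ, E[p^k]) = ker(H¹(K_λ, E[p^k]) →
H¹(K[ℓ]_λ, E[p^k]))`, printed §3.1.2) with THREE properties: the reconciliation `hT` with lit-ty's
GLOBAL rendering `Jetchev2008.transverseKer` (the currency of the typed Prop. 5.3 / `IsGlobalCoreVertex`),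
`τ`-stability and self-duality. Session g3 rendered `𝒯_λ` as the IMAGE `loc_λ(⋂ transverseKer ℓ)`
(`exists_transverseFamily`, p505818), for which `hT` is a theorem but self-duality is NOT a local
statement (it needs `loc_λ` onto, a Chebotarev-type fact). This file renders `𝒯_λ` by the tree's
INTRINSIC local object — `DiscreteGaloisModule.transverseSubgroup ρ L = ker(H¹(F, M) → H¹(L, M))`
(`Literature/…/GaloisCohomology/KolyvaginSystems`, Mazur–Rubin Def. 1.1.6 / Rubin Def. 1.9.4) with
`F = K_λ`, `M = E[n]`, `L = K[ℓ]_{w'}` the completion of the ring class field at a place `w'` over `λ`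
(local base change `adicCompletionOfLiesOver`, tree) — and PROVES `hT` for it:
* `localization_mem_transverseSubgroup_iff` (G2♯, any discrete module, any finite `L/K`, `w' ∣ v`):
  `loc_v x ∈ transverseSubgroup (M|_{K_v}) (L_{w'}) ↔ loc_{w'} (res_{L/K} x) = 0`. The two routes
  `Γ_{L_{w'}} → Γ_K` are conjugate by some `τ ∈ Γ_K` (tree `exists_absGaloisRestrict_adicCompletion_eq_conj`)
  and conjugation by `τ` moves coboundaries to coboundaries (explicit: `m ↦ ρ(τ)m − φ(τ)`); session
  g3's `exists_localRestriction_compat` (p505076) recorded only the existence of a compatible map.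
* `exists_localTransverseFamily`: for every conductor `c ≠ 0` the structure with
  `𝒯_v = ⨅_{ℓ ∣ c, ℓ ∈ v} ⨅_{w' ∣ v} transverseSubgroup (E[n]|_{K_v}) (K[ℓ]_{w'})` at the finite
  places satisfies `hT` VERBATIM — no inertness needed.
So the transverse inputs of the H63 line are now statements about ONE standard local object, for
which `τ`-stability and self-duality are Mazur–Rubin Prop. 1.3.2 (ii) / Howard Thm. 2.1.11-shaped
LOCAL lemmas (the tree already proves the cyclotomic analogue: `GaloisImage/TransverseOrthogonal`,
`X5/TransverseSelfDual`). References: [cite: Jetchev2008, §3.1.2 (p. 814), §3.4.1 (p. 816)]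
[cite: MazurRubin2004, Def. 1.1.6, Prop. 1.3.2 (ii)] [cite: Rubin2011, Def. 1.9.4]
[cite: SerreLocalFields1979, VII.§5 Prop. 3].
-/

set_option autoImplicit false

noncomputable section

open scoped Classical

open IsDedekindDomain NumberField Field WeierstrassCurve
  Literature.NumberTheory.GaloisRepresentations
  Literature.NumberTheory.GaloisRepresentations.DiscreteGaloisModule
  Literature.NumberTheory.Automorphic Literature
  Literature.NumberTheory.EllipticCurves Literature.NumberTheory.EllipticCurves.Jetchev2008
  Summit.BirchSwinnertonDyer.Rank1Residual.JET.SelmerVocabulary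

namespace Summit.BirchSwinnertonDyer.Rank1Residual.JET

/-! ## §1 G2♯: `loc_v x` is `L_{w'}`-transverse iff `loc_{w'} (res_{L/K} x) = 0` -/

section G2

variable {K : Type} [Field K] [NumberField K] {M : Type} [AddCommGroup M] [TopologicalSpace M]
  [DiscreteTopology M]

/-- **G2♯ (functoriality of restriction on local cohomology, kernel form).** For a discrete
`Γ_K`-module `M` over a number field `K`, a finite extension `L/K`, a place `v` of `K` and a place
`w'` of `L` over it (local base change `K_v → L_{w'}`, `adicCompletionOfLiesOver`), and every
`x ∈ H¹(K, M)`: `loc_v x` lies in the `L_{w'}`-transverse subgroup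
`ker(H¹(K_v, M) → H¹(L_{w'}, M))` (tree `transverseSubgroup`) iff `loc_{w'} (res_{L/K} x) = 0`. The two
routes `Γ_{L_{w'}} → Γ_{K_v} → Γ_K` and `Γ_{L_{w'}} → Γ_L → Γ_K` are conjugate by some `τ ∈ Γ_K`
(tree `exists_absGaloisRestrict_adicCompletion_eq_conj`); on cocycles `φ(τ g τ⁻¹) = φ(τ) + τφ(g) −
(τgτ⁻¹)φ(τ)`, so one pull-back is a coboundary iff the other is (`m ↦ τ m − φ(τ)`).
[cite: SerreLocalFields1979, VII.§5 Prop. 3] [cite: MazurRubin2004, Def. 1.1.6]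
[cite: Jetchev2008, §3.1.2 (p. 814)] -/
theorem localization_mem_transverseSubgroup_iff (ρ : DiscreteGaloisModule K M)
    (L : Type) [Field L] [NumberField L] [Algebra K L]
    (v : HeightOneSpectrum (𝓞 K)) (w : HeightOneSpectrum (𝓞 L)) [w.asIdeal.LiesOver v.asIdeal]
    (x : galoisCohomology ρ 1) :
    letI := (adicCompletionOfLiesOver K L v w).toAlgebra
    galoisCohomology.localization ρ (Sum.inr v) 1 x ∈
        transverseSubgroup (GaloisRep.toLocal v ρ) (w.adicCompletion L) ↔
      galoisCohomology.localization (ρ.restrictField L) (Sum.inr w) 1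
        (galoisCohomology.res ρ L 1 x) = 0 := by
  letI := (adicCompletionOfLiesOver K L v w).toAlgebra
  obtain ⟨τ, hτ⟩ := exists_absGaloisRestrict_adicCompletion_eq_conj (F := K) (E := L) v w
  -- the two routes `Γ_{L_w} → Γ_K`
  let f₁ : absoluteGaloisGroup (w.adicCompletion L) →ₜ* absoluteGaloisGroup K :=
    (absGaloisRestrict K L).comp (absGaloisRestrict L (w.adicCompletion L))
  let θ : absoluteGaloisGroup (w.adicCompletion L) →ₜ* absoluteGaloisGroup (v.adicCompletion K) :=
    absGaloisRestrict (v.adicCompletion K) (w.adicCompletion L)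
  let f₂ : absoluteGaloisGroup (w.adicCompletion L) →ₜ* absoluteGaloisGroup K :=
    (absGaloisRestrict K (v.adicCompletion K)).comp θ
  have hconj : ∀ σ, f₁ σ = τ * f₂ σ * τ⁻¹ := fun σ ↦ hτ σ
  -- the topological representations
  let X : TopRep ℤ (absoluteGaloisGroup (v.adicCompletion K)) :=
    DiscreteGaloisModule.toTopRep (ρ.toLocal (Sum.inr v : Place K))
  let Y : TopRep ℤ (absoluteGaloisGroup (w.adicCompletion L)) :=
    DiscreteGaloisModule.toTopRep (DiscreteGaloisModule.toLocal (ρ.restrictField L) (Sum.inr w : Place L))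
  let Z : TopRep ℤ (absoluteGaloisGroup (w.adicCompletion L)) :=
    DiscreteGaloisModule.toTopRep ((GaloisRep.toLocal v ρ).restrictField (w.adicCompletion L))
  have hY : ∀ g, Y.ρ g = ρ.toTopRep.ρ (f₁ g) := fun _ ↦ rfl
  have hZ : ∀ g, Z.ρ g = ρ.toTopRep.ρ (f₂ g) := fun _ ↦ rfl
  -- `ρ (a b) m = ρ a (ρ b m)`
  have hmul : ∀ (a b : absoluteGaloisGroup K) (m : M),
      ρ.toTopRep.ρ (a * b) m = ρ.toTopRep.ρ a (ρ.toTopRep.ρ b m) := fun a b m ↦ by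
    rw [map_mul]; rfl
  have hone : ∀ m : M, ρ.toTopRep.ρ 1 m = m := fun m ↦ by rw [map_one]; rfl
  obtain ⟨φ, rfl⟩ := oneCocycleClass_surjective ρ.toTopRep x
  -- unfold the maps on cocycles
  have hloc : galoisCohomology.localization ρ (Sum.inr v) 1 (oneCocycleClass _ φ) =
      oneCocycleClass X (contOneCocycles.pullback (absGaloisRestrict K (v.adicCompletion K))
        (TopRep.ofHom ⟨ContinuousLinearMap.id ℤ M, fun _ => rfl⟩) φ) :=
    map_oneCocycleClass _ _ _ φ
  have hres : galoisCohomology.localization (ρ.restrictField L) (Sum.inr w) 1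
        (galoisCohomology.res ρ L 1 (oneCocycleClass _ φ)) =
      oneCocycleClass Y (contOneCocycles.pullback (absGaloisRestrict L (w.adicCompletion L))
        (TopRep.ofHom ⟨ContinuousLinearMap.id ℤ M, fun _ => rfl⟩)
        (contOneCocycles.pullback (absGaloisRestrict K L)
          (TopRep.ofHom ⟨ContinuousLinearMap.id ℤ M, fun _ => rfl⟩) φ)) := by
    change galoisCohomology.localization (ρ.restrictField L) (Sum.inr w) 1
      (ContinuousCohomology.map _ _ 1 (oneCocycleClass _ φ)) = _
    rw [map_oneCocycleClass]
    exact map_oneCocycleClass _ _ _ _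
  have hres₀ : ∀ ψ : contOneCocycles X,
      galoisCohomology.res (GaloisRep.toLocal v ρ) (w.adicCompletion L) 1
          (oneCocycleClass X ψ) =
        oneCocycleClass Z (contOneCocycles.pullback θ
          (TopRep.ofHom ⟨ContinuousLinearMap.id ℤ M, fun _ => rfl⟩) ψ) := fun ψ ↦
    map_oneCocycleClass _ _ _ ψ
  change galoisCohomology.res (GaloisRep.toLocal v ρ) (w.adicCompletion L) 1
      (galoisCohomology.localization ρ (Sum.inr v) 1 (oneCocycleClass _ φ)) = 0 ↔ _
  rw [hloc, hres₀, hres]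
  -- the cocycle identity `φ(τ g τ⁻¹) = φ τ + τ φ(g) − (τ g τ⁻¹) φ τ`
  have hinv : ρ.toTopRep.ρ τ (φ.1 τ⁻¹) = -φ.1 τ := by
    have h := φ.2 τ τ⁻¹
    rw [mul_inv_cancel, contOneCocycles.apply_one] at h
    exact (neg_eq_of_add_eq_zero_right h.symm).symm
  have hkey : ∀ g, φ.1 (f₁ g) =
      φ.1 τ + ρ.toTopRep.ρ τ (φ.1 (f₂ g)) - ρ.toTopRep.ρ (f₁ g) (φ.1 τ) := by
    intro g
    rw [hconj g]
    have h1 : φ.1 (τ * f₂ g * τ⁻¹) = φ.1 (τ * f₂ g) + ρ.toTopRep.ρ (τ * f₂ g) (φ.1 τ⁻¹) := φ.2 _ _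
    have h2 : φ.1 (τ * f₂ g) = φ.1 τ + ρ.toTopRep.ρ τ (φ.1 (f₂ g)) := φ.2 _ _
    have h3 : ρ.toTopRep.ρ (τ * f₂ g) (φ.1 τ⁻¹) = -(ρ.toTopRep.ρ (τ * f₂ g * τ⁻¹) (φ.1 τ)) := by
      rw [← map_neg, ← hinv, ← hmul, inv_mul_cancel_right]
    rw [h1, h2, h3]
    abel
  constructor
  · -- `Z`-coboundary with `m` ⇒ `Y`-coboundary with `τ m − φ τ`
    intro h
    obtain ⟨m, hm⟩ := (oneCocycleClass_eq_zero_iff _ _).mp h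
    refine (oneCocycleClass_eq_zero_iff _ _).mpr ⟨ρ.toTopRep.ρ τ m - φ.1 τ, fun g ↦ ?_⟩
    have hm' : φ.1 (f₂ g) = ρ.toTopRep.ρ (f₂ g) m - m := hm g
    rw [contOneCocycles.pullback_apply, contOneCocycles.pullback_apply]
    change φ.1 (f₁ g) = Y.ρ g (ρ.toTopRep.ρ τ m - φ.1 τ) - (ρ.toTopRep.ρ τ m - φ.1 τ)
    rw [hY, hkey g, hm', map_sub, map_sub, ← hmul, ← hmul, hconj g, inv_mul_cancel_right]
    abel
  · -- `Y`-coboundary with `m'` ⇒ `Z`-coboundary with `τ⁻¹ (m' + φ τ)`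
    intro h
    obtain ⟨m', hm'⟩ := (oneCocycleClass_eq_zero_iff _ _).mp h
    refine (oneCocycleClass_eq_zero_iff _ _).mpr ⟨ρ.toTopRep.ρ τ⁻¹ (m' + φ.1 τ), fun g ↦ ?_⟩
    have h' : φ.1 (f₁ g) = ρ.toTopRep.ρ (f₁ g) m' - m' := hm' g
    rw [contOneCocycles.pullback_apply]
    change φ.1 (f₂ g) = Z.ρ g (ρ.toTopRep.ρ τ⁻¹ (m' + φ.1 τ)) - ρ.toTopRep.ρ τ⁻¹ (m' + φ.1 τ)
    rw [hZ, ← hmul]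
    -- apply `ρ τ` to both sides
    have hinj : Function.Injective (ρ.toTopRep.ρ τ) := fun a b hab ↦ by
      have := congrArg (ρ.toTopRep.ρ τ⁻¹) hab
      rwa [← hmul, ← hmul, inv_mul_cancel, hone, hone] at this
    apply hinj
    rw [map_sub, ← hmul, ← hmul, mul_inv_cancel, hone, ← mul_assoc, ← hconj g]
    have := hkey g
    rw [h'] at this
    -- `this : ρ(f₁ g) m' − m' = φ τ + ρ τ (φ (f₂ g)) − ρ (f₁ g) (φ τ)`
    rw [map_add]
    have e : ρ.toTopRep.ρ τ (φ.1 (f₂ g)) =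
        ρ.toTopRep.ρ (f₁ g) m' - m' - φ.1 τ + ρ.toTopRep.ρ (f₁ g) (φ.1 τ) := by
      rw [this]; abel
    rw [e]
    abel

end G2

/-! ## §2 The intrinsic transverse family and its reconciliation `hT` -/

section Family

variable {K : Type} [Field K] [NumberField K]

/-- **Jetchev's transverse family by the tree's intrinsic local object, with the reconciliation
`hT` PROVED.** For `W/ℚ`, a level `n`, an embedding `ι`, a conductor `c ≠ 0`: the Selmer structure
`𝒯` on `E[n]/K` with, at a finite place `v`,
`𝒯_v = ⨅_{ℓ ∣ c, ℓ ∈ v} ⨅_{w' ∣ v} ker(H¹(K_v, E[n]) → H¹(K[ℓ]_{w'}, E[n]))`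
(`transverseSubgroup` along the local base change `K_v → K[ℓ]_{w'}`; printed §3.1.2
`H¹_tr(K_λ, E[p^m]) = ker{H¹(K_λ, E[p^m]) → H¹(K[ℓ]_λ, E[p^m])}`), and everything at the infinite
places, satisfies: for every `x ∈ H¹(K, E[n])`, `loc_v x ∈ 𝒯_v` for all `v ∣ c` iff
`x ∈ transverseKer ℓ` for all `ℓ ∣ c` (lit-ty's global rendering: `loc_{w'} (res_{K[ℓ]/K} x) = 0` for
every place `w' ∋ ℓ` of `K[ℓ]`) — by G2♯ place by place (a place `w' ∋ ℓ` of `K[ℓ]` lies over the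
place `w' ∩ 𝓞_K ∋ ℓ` of `K`, which divides `c`). This is the hypothesis `hT` of
`JET.tamagawaExponent_le_mInfty_of_localInputs` for the intrinsic rendering.
[cite: Jetchev2008, §3.1.2 (p. 814), §3.4.1 (p. 816)] [cite: MazurRubin2004, Def. 1.1.6]
[cite: Rubin2011, Def. 1.9.4] -/
theorem exists_localTransverseFamily (W : WeierstrassCurve ℚ) (ι : K →+* ℂ) (n : ℤ)
    [∀ k : ℕ, NumberField (ringClassField K ι k)] {c : ℕ} (hc : c ≠ 0) :
    ∃ 𝒯 : SelmerStructure ((W.baseChange K).torsionGaloisModule n),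
      (∀ v : HeightOneSpectrum (𝓞 K), 𝒯 (Sum.inr v) =
        ⨅ ℓ ∈ c.primeFactors.filter (fun ℓ : ℕ ↦ ((ℓ : ℕ) : 𝓞 K) ∈ v.asIdeal),
          ⨅ (w' : HeightOneSpectrum (𝓞 (ringClassField K ι ℓ)))
            (_ : w'.asIdeal.LiesOver v.asIdeal),
            letI := (adicCompletionOfLiesOver K (ringClassField K ι ℓ) v w').toAlgebra
            transverseSubgroup (GaloisRep.toLocal v ((W.baseChange K).torsionGaloisModule n))
              (w'.adicCompletion (ringClassField K ι ℓ))) ∧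
      ∀ x : galoisCohomology ((W.baseChange K).torsionGaloisModule n) 1,
        (∀ w ∈ placesDividing K c,
          galoisCohomology.localization ((W.baseChange K).torsionGaloisModule n) (Sum.inr w) 1 x ∈
            𝒯 (Sum.inr w)) ↔
        ∀ ℓ ∈ c.primeFactors, x ∈ transverseKer W K ι n ℓ := by
  -- notation
  let ρ := (W.baseChange K).torsionGaloisModule n
  let loc : ∀ v : HeightOneSpectrum (𝓞 K),
      galoisCohomology ρ 1 →+ galoisCohomology (ρ.toLocal (Sum.inr v : Place K)) 1 :=
    fun v ↦ galoisCohomology.localization ρ (Sum.inr v) 1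
  let T : ∀ v : HeightOneSpectrum (𝓞 K), AddSubgroup (galoisCohomology (ρ.toLocal (Sum.inr v : Place K)) 1) :=
    fun v ↦ ⨅ ℓ ∈ c.primeFactors.filter (fun ℓ : ℕ ↦ ((ℓ : ℕ) : 𝓞 K) ∈ v.asIdeal),
      ⨅ (w' : HeightOneSpectrum (𝓞 (ringClassField K ι ℓ))) (_ : w'.asIdeal.LiesOver v.asIdeal),
        letI := (adicCompletionOfLiesOver K (ringClassField K ι ℓ) v w').toAlgebra
        transverseSubgroup (GaloisRep.toLocal v ρ) (w'.adicCompletion (ringClassField K ι ℓ))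
  let 𝒯 : SelmerStructure ρ := fun v ↦
    match v with
    | Sum.inl _ => ⊤
    | Sum.inr v => T v
  have hmemT : ∀ (v : HeightOneSpectrum (𝓞 K)) (y : galoisCohomology (ρ.toLocal (Sum.inr v : Place K)) 1),
      y ∈ T v ↔ ∀ ℓ ∈ c.primeFactors, (ℓ : 𝓞 K) ∈ v.asIdeal →
        ∀ (w' : HeightOneSpectrum (𝓞 (ringClassField K ι ℓ))) (h : w'.asIdeal.LiesOver v.asIdeal),
          y ∈ (letI := (adicCompletionOfLiesOver K (ringClassField K ι ℓ) v w').toAlgebra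
            transverseSubgroup (GaloisRep.toLocal v ρ) (w'.adicCompletion (ringClassField K ι ℓ))) := by
    intro v y
    simp only [T, AddSubgroup.mem_iInf, Finset.mem_filter, and_imp]
    exact ⟨fun H ℓ hℓ hv w' h ↦ AddSubgroup.mem_iInf.mp (H ℓ hℓ hv w') h,
      fun H ℓ hℓ hv w' ↦ AddSubgroup.mem_iInf.mpr (H ℓ hℓ hv w')⟩
  -- a place `w'` of `K[ℓ]` containing `ℓ` lies over the place `w' ∩ 𝓞_K` of `K`, which contains `ℓ`
  refine ⟨𝒯, fun v ↦ rfl, fun x ↦ ⟨fun h ℓ hℓ ↦ ?_, fun h w hw ↦ ?_⟩⟩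
  · -- `⇒`
    have hℓp : ℓ.Prime := Nat.prime_of_mem_primeFactors hℓ
    rw [mem_transverseKer_iff]
    intro w' hw'
    have hunder : (ℓ : 𝓞 K) ∈ w'.asIdeal.under (𝓞 K) := by
      rw [Ideal.under, Ideal.mem_comap, map_natCast]
      exact hw'
    have hne : w'.asIdeal.under (𝓞 K) ≠ ⊥ := by
      intro hbot
      rw [hbot, Ideal.mem_bot] at hunder
      exact hℓp.ne_zero (by exact_mod_cast hunder)
    let v₀ : HeightOneSpectrum (𝓞 K) :=
      ⟨w'.asIdeal.under (𝓞 K), Ideal.IsPrime.under (𝓞 K) w'.asIdeal, hne⟩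
    haveI hLO : w'.asIdeal.LiesOver v₀.asIdeal := ⟨rfl⟩
    have hv₀c : v₀ ∈ placesDividing K c := by
      rw [mem_placesDividing_iff_natCast_mem hc]
      obtain ⟨q, hq⟩ := Nat.dvd_of_mem_primeFactors hℓ
      rw [hq, Nat.cast_mul]
      exact v₀.asIdeal.mul_mem_right _ hunder
    have hx : loc v₀ x ∈ T v₀ := h v₀ hv₀c
    have hx' := (hmemT v₀ (loc v₀ x)).mp hx ℓ hℓ hunder w' hLO
    exact (localization_mem_transverseSubgroup_iff ρ (ringClassField K ι ℓ) v₀ w' x).mp hx'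
  · -- `⇐`
    refine (hmemT w (loc w x)).mpr fun ℓ hℓ hℓw w' hLO ↦ ?_
    refine (localization_mem_transverseSubgroup_iff ρ (ringClassField K ι ℓ) w w' x).mpr ?_
    refine (mem_transverseKer_iff W K ι n ℓ x).mp (h ℓ hℓ) w' ?_
    have : (ℓ : 𝓞 K) ∈ w'.asIdeal.under (𝓞 K) := by rw [← hLO.over]; exact hℓw
    rw [Ideal.under, Ideal.mem_comap, map_natCast] at this
    exact this

end Family

end Summit.BirchSwinnertonDyer.Rank1Residual.JET

end
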